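import Summits.Ventures.GridStability.Lyapunov.GroundedLaplacianSparseCert
import Literature.Computation.Certificates.SparseMatrixAlgebra
import HarnessLib

/-!
# Grounded-Laplacian sparse certificates, STRUCTURAL form: rows computed in the kernel from the weight list (T-L2b, part 2)

Venture GRIDFUSION, G2-SCALE cell, lead g19 D13/D25 «T-L2b» (owner gridfusion-sos-5 g9). Part 1
(`GroundedLaplacianSparseCert.lean`) takes the target rows of `L_g − λI` as a literal list plus the
per-instance identity `matrixOfSparseRows m m rows = groundedLaplacianQ aQ g λ`, which an instance can only
decide ENTRYWISE (`m²` evaluations, each a positional list access: MEASURED 60 s of farm wall at `N = 100`,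
elaboration time-out at `N = 300`, 2026-08-28). This file removes every `N²` obligation:

* the weights are ONE sparse matrix literal `W : SMat ℚ` (row `i` = the (neighbour, weight) pairs of node
  `i`, `2|E|` pairs), read as the kernel `matrixOfSparseRows N N W`;
* symmetry of the weights is ONE `SMat.eqCheck N W (SMat.transpose d N W)` decide (`O(nnz·log N)`, lit-5's
  radix transpose), in-range columns ONE `colsBelow` decide (`O(nnz)`);
* the target rows are COMPUTED in the kernel: `groundedSMat m W g λ` (row `k` = the diagonal entry
  `Σ_u w_{vu} − λ` followed by the re-indexed negated neighbours of `v = g.succAbove k`; `O(nnz + N²)` list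
  steps in all), and `matrixOfSparseRows_groundedSMat` proves ONCE that they ARE `groundedLaplacianQ`;
* so an instance is: `W`, `g`, `λ`, the clique blocks `bs` (helpers `blk1` / `blk2` / `blk3` keep the
  literal cheap to elaborate), and four decides `colsBelow`, `eqCheck/transpose`, `cliqueSweepS`, `ldlAll`
  — certificate literals AND kernel time linear in `N(w+1)²` (`connectivity_certificate_of_grounded_smat`).

THREE COLUMNS. CERTIFIED (kernel): everything in this file. VALIDATED / MODELLED: nothing.
[cite: ZhengFantuzziPapachristodoulou2018, §3.2 Theorem 2 («if» direction); BarrettEtAl1994, §4.3.1 «Compressed Row Storage (CRS)», p. 57; DorflerBullo2013, arXiv:1102.2950 §2.6]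
-/

namespace Summit.Ventures.GridStability.Lyapunov

open Finset Matrix
open Literature.MathematicalPhysics.PowerSystems
open Literature.Computation.Certificates Literature.Computation.Certificates.PSD

variable {m : ℕ}

/-! ## Small block constructors (cheap literals) -/

/-- A `1 × 1` clique block `[a]` on member `i`. [cite: ZhengFantuzziPapachristodoulou2018, §3.2 (E_𝒞ᵀ Y E_𝒞)] -/
def blk1 (i : Fin m) (a : ℚ) : Block m ℚ := ⟨[i], !![a]⟩

/-- A symmetric `2 × 2` clique block `[a b; b c]` on members `i, j`. [cite: ZhengFantuzziPapachristodoulou2018, §3.2 (E_𝒞ᵀ Y E_𝒞)] -/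
def blk2 (i j : Fin m) (a b c : ℚ) : Block m ℚ := ⟨[i, j], !![a, b; b, c]⟩

/-- A symmetric `3 × 3` clique block `[a b c; b d e; c e f]` on members `i, j, k`. [cite: ZhengFantuzziPapachristodoulou2018, §3.2 (E_𝒞ᵀ Y E_𝒞)] -/
def blk3 (i j k : Fin m) (a b c d e f : ℚ) : Block m ℚ := ⟨[i, j, k], !![a, b, c; b, d, e; c, e, f]⟩

/-! ## Reading a sparse weight matrix -/

/-- The total of the values stored in a sparse row (= its row sum when every column is in range).
[cite: BarrettEtAl1994, §4.3.1, p. 57] -/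
def srowTotal (r : SRow ℚ) : ℚ := (r.map Prod.snd).sum

/-- Every stored column index of every row is `< n`. [cite: BarrettEtAl1994, §4.3.1, p. 57] -/
def colsBelow (n : ℕ) (W : SMat ℚ) : Bool := W.all fun r => r.all fun p => decide (p.1 < n)

/-- Row sum over `Fin n` of a sparse row with in-range columns = the total of its stored values.
[cite: BarrettEtAl1994, §4.3.1, p. 57] -/
theorem sum_fn_eq_srowTotal {n : ℕ} (r : SRow ℚ) (h : (r.all fun p => decide (p.1 < n)) = true) :
    ∑ j : Fin n, SRow.fn r j.val = srowTotal r := by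
  induction r with
  | nil => simp [srowTotal]
  | cons p r ih =>
    obtain ⟨u, w⟩ := p
    rw [List.all_cons, Bool.and_eq_true, decide_eq_true_eq] at h
    have hs : srowTotal ((u, w) :: r) = w + srowTotal r := by simp [srowTotal]
    simp only [SRow.fn_cons, Finset.sum_add_distrib, ih h.2, hs]
    congr 1
    rw [Finset.sum_eq_single ⟨u, h.1⟩ (fun b _ hb => if_neg fun hub => hb (Fin.ext hub.symm))
      (fun hnot => absurd (Finset.mem_univ _) hnot)]
    simp

/-- Symmetry of the kernel matrix of `W` from ONE sparse check against lit-5's radix transpose.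
[cite: BarrettEtAl1994, §4.3.1 (CCS is CRS of Aᵀ), p. 57] -/
theorem symm_of_eqCheck_transpose {n d : ℕ} (hn : n ≤ 2 ^ d) (W : SMat ℚ)
    (h : SMat.eqCheck n W (SMat.transpose d n W) = true) :
    ∀ i j : Fin n, matrixOfSparseRows n n W i j = matrixOfSparseRows n n W j i := by
  intro i j
  have e := SMat.matrixOfSparseRows_eq_of_eqCheck n h
  rw [SMat.matrixOfSparseRows_transpose n hn] at e
  have hij := congr_fun (congr_fun e i) j
  rwa [Matrix.transpose_apply] at hij

/-! ## Grounded indexing on values -/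

/-- The node carried by grounded index `k` (`= (g.succAbove k).val`). [cite: DorflerBullo2013, arXiv:1102.2950 §2.6] -/
def groundNode (g k : ℕ) : ℕ := if k < g then k else k + 1

/-- The grounded index of node `u` (the junk column `m`, never read, for the grounded node itself).
[cite: DorflerBullo2013, arXiv:1102.2950 §2.6] -/
def groundIdx (m g u : ℕ) : ℕ := if u = g then m else if u < g then u else u - 1

/-- `Fin.succAbove` on values is `groundNode`. [folklore] -/
theorem succAbove_val_eq_groundNode (g : Fin (m + 1)) (k : Fin m) :
    (g.succAbove k).val = groundNode g.val k.val := by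
  unfold groundNode
  by_cases h : k.val < g.val
  · rw [if_pos h, Fin.succAbove_of_castSucc_lt _ _ (Fin.lt_def.2 (by rw [Fin.val_castSucc]; exact h)),
      Fin.val_castSucc]
  · rw [if_neg h, Fin.succAbove_of_le_castSucc _ _ (Fin.le_def.2 (by rw [Fin.val_castSucc]; omega)),
      Fin.val_succ]

/-- Re-indexing law: for an in-range node `u` and a grounded index `j < m`, `groundIdx m g u = j ↔
u = groundNode g j`. [folklore] -/
theorem groundIdx_eq_iff {g u j : ℕ} (_hu : u < m + 1) (_hj : j < m) :
    groundIdx m g u = j ↔ u = groundNode g j := by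
  unfold groundIdx groundNode
  constructor <;> intro h' <;> split_ifs at * <;> omega

/-- The negated, re-indexed neighbour list reads `−w_{v, groundNode g j}` at column `j`.
[cite: BarrettEtAl1994, §4.3.1, p. 57] -/
theorem sum_map_groundIdx {g j : ℕ} (hj : j < m) (r : SRow ℚ)
    (h : (r.all fun p => decide (p.1 < m + 1)) = true) :
    (r.map fun p => if groundIdx m g p.1 = j then -p.2 else 0).sum = -SRow.fn r (groundNode g j) := by
  induction r with
  | nil => simp
  | cons p r ih =>
    obtain ⟨u, w⟩ := p
    rw [List.all_cons, Bool.and_eq_true, decide_eq_true_eq] at h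
    rw [List.map_cons, List.sum_cons, ih h.2, SRow.fn_cons, neg_add]
    congr 1
    by_cases hu : u = groundNode g j
    · rw [if_pos ((groundIdx_eq_iff h.1 hj).2 hu), if_pos hu]
    · rw [if_neg (mt (groundIdx_eq_iff h.1 hj).1 hu), if_neg hu, neg_zero]

/-! ## The grounded rows, computed -/

/-- Row `k` of `L_g − λI` as a sparse row, computed from the weight matrix: the diagonal entry
`Σ_u w_{vu} − λ` (`v = groundNode g k`) followed by `(groundIdx u, −w_{vu})` for every stored neighbour
`u` of `v` (the grounded node lands in the junk column `m`). [cite: DorflerBullo2013, arXiv:1102.2950 §2.6] -/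
def groundedRow (m : ℕ) (W : SMat ℚ) (g : ℕ) (lam : ℚ) (k : ℕ) : SRow ℚ :=
  (k, srowTotal (W.getD (groundNode g k) []) - lam) ::
    (W.getD (groundNode g k) []).map fun p => (groundIdx m g p.1, -p.2)

/-- All `m` grounded rows. [cite: DorflerBullo2013, arXiv:1102.2950 §2.6] -/
def groundedSMat (m : ℕ) (W : SMat ℚ) (g : ℕ) (lam : ℚ) : SMat ℚ :=
  (List.range m).map (groundedRow m W g lam)

/-- **The computed rows ARE the grounded Laplacian** of the kernel weight matrix of `W` (columns in
range). [cite: DorflerBullo2013, arXiv:1102.2950 §2.6] -/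
theorem matrixOfSparseRows_groundedSMat (W : SMat ℚ) (hW : colsBelow (m + 1) W = true)
    (g : Fin (m + 1)) (lam : ℚ) :
    matrixOfSparseRows m m (groundedSMat m W g.val lam)
      = groundedLaplacianQ (matrixOfSparseRows (m + 1) (m + 1) W) g lam := by
  ext k j
  have hrow : (groundedSMat m W g.val lam).getD k.val [] = groundedRow m W g.val lam k.val := by
    rw [groundedSMat, List.getD_eq_getElem?_getD, List.getElem?_map, List.getElem?_range k.isLt]
    rfl
  have hcols : ((W.getD (groundNode g.val k.val) []).all fun p => decide (p.1 < m + 1)) = true := by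
    rw [List.getD_eq_getElem?_getD]
    cases hW' : W[groundNode g.val k.val]? with
    | none => rfl
    | some r =>
      rw [Option.getD_some]
      exact (List.all_eq_true.1 hW) r (List.mem_of_getElem? hW')
  rw [matrixOfSparseRows_apply, hrow, groundedRow, SRow.fn_cons, SRow.fn_map_pair, groundedLaplacianQ,
    Matrix.of_apply]
  simp only [matrixOfSparseRows_apply, succAbove_val_eq_groundNode]
  rw [sum_fn_eq_srowTotal _ hcols, sum_map_groundIdx j.isLt _ hcols]
  by_cases hkj : k = j
  · subst hkj
    rw [if_pos rfl, if_pos rfl]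
    ring
  · rw [if_neg (fun h => hkj (Fin.ext h)), if_neg hkj, zero_add, zero_sub]

/-- **T-L2b, structural form: the variational connectivity certificate from a sparse weight matrix and
clique blocks only.** Instance obligations, all linear in the data: `hW` (columns in range), `hsym` (ONE
`eqCheck` against the radix transpose, `m + 1 ≤ 2^d`), `hsweep` (row-streamed clique-sum identity of the
COMPUTED rows `groundedSMat`), `hldl` (every block PSD by in-kernel exact `LDLᵀ`). Conclusion = the `hlam`
hypothesis of the dVOC Condition-2 / droop / Kuramoto chains for the weights `matrixOfSparseRows N N W`.
[cite: ZhengFantuzziPapachristodoulou2018, §3.2 Theorem 2 («if» direction); DorflerBullo2012, arXiv:0910.5673 §5.2 Lemma 5.9] -/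
theorem connectivity_certificate_of_grounded_smat {d : ℕ} (W : SMat ℚ) (hd : m + 1 ≤ 2 ^ d)
    (hW : colsBelow (m + 1) W = true)
    (hsym : SMat.eqCheck (m + 1) W (SMat.transpose d (m + 1) W) = true)
    (g : Fin (m + 1)) (lam : ℚ) (hlam : 0 ≤ lam) (bs : List (Block m ℚ))
    (hsweep : cliqueSweepS m 0 m (groundedSMat m W g.val lam) bs = true) (hldl : ldlAll bs = true) :
    ∀ z : Fin (m + 1) → ℝ,
      (lam : ℝ) * pairNormSq z
        ≤ ((m + 1 : ℕ) : ℝ) *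
          (1 / 2 * ∑ i, ∑ j, ((matrixOfSparseRows (m + 1) (m + 1) W i j : ℚ) : ℝ) * (z i - z j) ^ 2) :=
  connectivity_certificate_of_grounded_sparseCert _ (symm_of_eqCheck_transpose hd W hsym) g lam hlam _ bs
    (matrixOfSparseRows_groundedSMat W hW g lam) hsweep hldl

/-! ## In-range rows for the sweep

`matrixOfSparseRows m m` never reads a stored column `≥ m`, but the residual test of `cliqueSweepS`
inspects EVERY stored entry — so the junk-column entries `(m, −w_{v g})` that `groundedRow` stores for the
neighbours of the grounded node make the sweep answer `false` on every connected graph (MEASURED on the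
D1 / feeder instances, 2026-08-28). `groundedSMatIn` drops them with lit-5's `SRow.takeCols` (one filter
pass per row); it reads as the same matrix, and is the form instances decide. -/

/-- The grounded rows with the out-of-range (grounded-node) entries dropped — the rows an instance
hands to `cliqueSweepS`. [cite: DorflerBullo2013, arXiv:1102.2950 §2.6] -/
def groundedSMatIn (m : ℕ) (W : SMat ℚ) (g : ℕ) (lam : ℚ) : SMat ℚ :=
  (groundedSMat m W g lam).map (SRow.takeCols m)

/-- Dropping the stored columns `≥ n` of every row does not change the `m × n` matrix read.
[cite: BarrettEtAl1994, §4.3.1, p. 57] -/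
theorem matrixOfSparseRows_map_takeCols (m n : ℕ) (A : SMat ℚ) :
    matrixOfSparseRows m n (A.map (SRow.takeCols n)) = matrixOfSparseRows m n A := by
  ext i j
  rw [matrixOfSparseRows_apply, matrixOfSparseRows_apply, List.getD_eq_getElem?_getD,
    List.getD_eq_getElem?_getD, List.getElem?_map]
  cases A[i.val]? with
  | none => rfl
  | some r => rw [Option.map_some, Option.getD_some, Option.getD_some, SRow.fn_takeCols, if_pos j.isLt]

/-- **The in-range computed rows ARE the grounded Laplacian.** [cite: DorflerBullo2013, arXiv:1102.2950 §2.6] -/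
theorem matrixOfSparseRows_groundedSMatIn (W : SMat ℚ) (hW : colsBelow (m + 1) W = true)
    (g : Fin (m + 1)) (lam : ℚ) :
    matrixOfSparseRows m m (groundedSMatIn m W g.val lam)
      = groundedLaplacianQ (matrixOfSparseRows (m + 1) (m + 1) W) g lam := by
  rw [groundedSMatIn, matrixOfSparseRows_map_takeCols, matrixOfSparseRows_groundedSMat W hW]

/-- **T-L2b, structural form, as decided by instances** (`hsweep` on `groundedSMatIn`): sparse weight
matrix + clique blocks + four linear-cost decides ⇒ the variational connectivity certificate for the weights
`matrixOfSparseRows N N W`. [cite: ZhengFantuzziPapachristodoulou2018, §3.2 Theorem 2 («if» direction); DorflerBullo2012, arXiv:0910.5673 §5.2 Lemma 5.9] -/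
theorem connectivity_certificate_of_grounded_smatIn {d : ℕ} (W : SMat ℚ) (hd : m + 1 ≤ 2 ^ d)
    (hW : colsBelow (m + 1) W = true)
    (hsym : SMat.eqCheck (m + 1) W (SMat.transpose d (m + 1) W) = true)
    (g : Fin (m + 1)) (lam : ℚ) (hlam : 0 ≤ lam) (bs : List (Block m ℚ))
    (hsweep : cliqueSweepS m 0 m (groundedSMatIn m W g.val lam) bs = true) (hldl : ldlAll bs = true) :
    ∀ z : Fin (m + 1) → ℝ,
      (lam : ℝ) * pairNormSq z
        ≤ ((m + 1 : ℕ) : ℝ) *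
          (1 / 2 * ∑ i, ∑ j, ((matrixOfSparseRows (m + 1) (m + 1) W i j : ℚ) : ℝ) * (z i - z j) ^ 2) :=
  connectivity_certificate_of_grounded_sparseCert _ (symm_of_eqCheck_transpose hd W hsym) g lam hlam _ bs
    (matrixOfSparseRows_groundedSMatIn W hW g lam) hsweep hldl

end Summit.Ventures.GridStability.Lyapunov
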